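import Mathlib
import HarnessLib
import Literature.Geometry.DiscreteGeometry.SphericalCodeHullEulerFormula

/-!
# Soft four-rings, endgame: index bookkeeping at a type-O vertex

Support file for `SoftFourRings` (route `PricedLinkCensus`, sub-problem `Crystallization`),
endgame step (E5) of the evidence file (§12.8): for type-O index data (bonded link pairs
`{i, j}` and `{k, l}`), `eq_j_of_bond_i` (a bonded pair containing `i` is `{i, j}`) and
`not_mem_bonds_cross` (no bonded pair joins `{i, j}` to `{k, l}`).
-/

namespace Summit.AtomisticToContinuum.Crystallization.Theorems

open Real RealInnerProductSpace

section Setting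

variable {B : Finset (Finset (EuclideanSpace ℝ (Fin 3)))} (w : Fin 4 → EuclideanSpace ℝ (Fin 3))
  {i j k l : Fin 4} (hnd : [i, j, k, l].Nodup)
  (hNB : ∀ a b : Fin 4, a ≠ b → ({w a, w b} : Finset (EuclideanSpace ℝ (Fin 3))) ∈ B →
    ({a, b} : Finset (Fin 4)) = {i, j} ∨ ({a, b} : Finset (Fin 4)) = {k, l})

include hnd hNB in
/-- The bonded pairs containing `i` are only `{i, j}`. -/
theorem eq_j_of_bond_i (s : Fin 4) (hs : s ≠ i)
    (h : ({w s, w i} : Finset (EuclideanSpace ℝ (Fin 3))) ∈ B) : s = j := by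
  have hnd' : (i ≠ j ∧ i ≠ k ∧ i ≠ l) ∧ (j ≠ k ∧ j ≠ l) ∧ k ≠ l := by
    simp only [List.nodup_cons, List.mem_cons, not_or, List.not_mem_nil,
      not_false_eq_true, and_true, List.nodup_nil] at hnd
    exact hnd
  rcases hNB s i hs h with h' | h'
  · have hs' : s ∈ ({i, j} : Finset (Fin 4)) := by rw [← h']; simp
    simp only [Finset.mem_insert, Finset.mem_singleton] at hs'
    rcases hs' with e | e
    · exact absurd e hs
    · exact e
  · have hi' : i ∈ ({k, l} : Finset (Fin 4)) := by rw [← h']; simp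
    simp only [Finset.mem_insert, Finset.mem_singleton] at hi'
    rcases hi' with e | e
    · exact absurd e hnd'.1.2.1
    · exact absurd e hnd'.1.2.2

include hnd hNB in
/-- No bonded pair joins `i` to `k` or `l`, nor `j` to `k` or `l`. -/
theorem not_mem_bonds_cross (s t : Fin 4) (hs : s = i ∨ s = j) (ht : t = k ∨ t = l) :
    ({w s, w t} : Finset (EuclideanSpace ℝ (Fin 3))) ∉ B := by
  have hnd' : (i ≠ j ∧ i ≠ k ∧ i ≠ l) ∧ (j ≠ k ∧ j ≠ l) ∧ k ≠ l := by
    simp only [List.nodup_cons, List.mem_cons, not_or, List.not_mem_nil,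
      not_false_eq_true, and_true, List.nodup_nil] at hnd
    exact hnd
  intro h
  have hst : s ≠ t := by
    rcases hs with rfl | rfl <;> rcases ht with rfl | rfl
    exacts [hnd'.1.2.1, hnd'.1.2.2, hnd'.2.1.1, hnd'.2.1.2]
  rcases hNB s t hst h with h' | h'
  · have : t ∈ ({i, j} : Finset (Fin 4)) := by rw [← h']; simp
    simp only [Finset.mem_insert, Finset.mem_singleton] at this
    rcases ht with rfl | rfl <;> rcases this with e | e
    exacts [hnd'.1.2.1 e.symm, hnd'.2.1.1 e.symm, hnd'.1.2.2 e.symm, hnd'.2.1.2 e.symm]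
  · have : s ∈ ({k, l} : Finset (Fin 4)) := by rw [← h']; simp
    simp only [Finset.mem_insert, Finset.mem_singleton] at this
    rcases hs with rfl | rfl <;> rcases this with e | e
    exacts [hnd'.1.2.1 e, hnd'.1.2.2 e, hnd'.2.1.1 e, hnd'.2.1.2 e]

end Setting

end Summit.AtomisticToContinuum.Crystallization.Theorems
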